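import Mathlib

/-!
# Planar exposed-point counting (helpers for stub S1 `stub_tropicalWordBound` of line `Sketch`,
# crux `WordPerSuperPoly`, stmt-ValiantsHypothesis-6626)

For a finite set `S ⊆ ℝ²` (points `Fin 2 → ℝ`) and a sign `σ : ℝ`, call `p ∈ S` *`σ`-exposed* if
some functional `ℓ_t (x, y) = t·x + σ·y` is maximised over `S` at `p` alone.  The predicate is
written out verbatim in every statement (no definitions are introduced):
`∀ q ∈ S, q ≠ p → t * q 0 + σ * q 1 < t * p 0 + σ * p 1`.

Results:
* `card_succ_le_card_image_add`: two functions on a finite set of reals with interval fibres,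
  jointly injective, take at least `#domain + 1` values in total (the sweep lemma);
* `ncard_exposed_union_le`: `σ`-exposed points are subadditive under union;
* `ncard_exposed_add_le`: `σ`-exposed points are subadditive under Minkowski sum (sweep: along
  increasing `t` the maximiser over `S` never returns to a value it has left);
* `ncard_extremePoints_convexHull_le`: every vertex of `conv S` is `1`-exposed or `(-1)`-exposed
  (Hahn–Banach separation from `conv (S ∖ {p})`, perturbing a vertical separating direction);
* `stub_exposedPlanarGeometry`: the last three bundled — the statement registered on the crux item
  as the helper stub this file proves.

These are the geometric inputs of the tropical (cancellation-free) word bound.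
-/

-- `Summit.ValiantsHypothesis.ValiantsHypothesis.…` is the tree's mandated single-conjunct layout.
set_option linter.dupNamespace false

namespace Summit.ValiantsHypothesis.ValiantsHypothesis.Theorems.ElementaryWordLengthWordPerSuperPoly

open Set
open scoped Pointwise

/-! ## The sweep lemma -/

/-- **Sweep lemma.** If `f, g` are functions on a finite nonempty set `P ⊆ ℝ` whose fibres are
order-convex in `P` and `t ↦ (f t, g t)` is injective on `P`, then `#P + 1 ≤ #f(P) + #g(P)`:
between consecutive points one of `f, g` changes, and a function with interval fibres taking `a`
values changes at most `a - 1` times. [folklore] -/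
theorem card_succ_le_card_image_add {α β : Type} [DecidableEq α] [DecidableEq β]
    (P : Finset ℝ) (f : ℝ → α) (g : ℝ → β)
    (hf : ∀ a ∈ P, ∀ b ∈ P, ∀ c ∈ P, a < b → b < c → f a = f c → f b = f c)
    (hg : ∀ a ∈ P, ∀ b ∈ P, ∀ c ∈ P, a < b → b < c → g a = g c → g b = g c)
    (hinj : Set.InjOn (fun t => (f t, g t)) P) (hP : P.Nonempty) :
    P.card + 1 ≤ (P.image f).card + (P.image g).card := by
  classical
  induction P using Finset.induction_on_max with
  | empty => exact absurd hP Finset.not_nonempty_empty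
  | insert a s ha ih =>
    have hane : a ∉ s := fun h => lt_irrefl a (ha a h)
    rcases s.eq_empty_or_nonempty with rfl | hs
    · simp
    set m := s.max' hs with hm
    have hms : m ∈ s := s.max'_mem hs
    have hma : m < a := ha m hms
    have hsub : (s : Set ℝ) ⊆ (insert a s : Finset ℝ) := by simp
    have hf' : ∀ x ∈ s, ∀ y ∈ s, ∀ z ∈ s, x < y → y < z → f x = f z → f y = f z :=
      fun x hx y hy z hz => hf x (Finset.mem_insert_of_mem hx) y (Finset.mem_insert_of_mem hy) z
        (Finset.mem_insert_of_mem hz)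
    have hg' : ∀ x ∈ s, ∀ y ∈ s, ∀ z ∈ s, x < y → y < z → g x = g z → g y = g z :=
      fun x hx y hy z hz => hg x (Finset.mem_insert_of_mem hx) y (Finset.mem_insert_of_mem hy) z
        (Finset.mem_insert_of_mem hz)
    have ih' := ih hf' hg' (hinj.mono hsub) hs
    have hne : (f m, g m) ≠ (f a, g a) := fun h =>
      hma.ne (hinj (hsub (Finset.mem_coe.2 hms)) (Finset.mem_coe.2 (Finset.mem_insert_self a s)) h)
    rw [Finset.card_insert_of_notMem hane, Finset.image_insert, Finset.image_insert]
    -- a function with interval fibres that changes between `m` and `a` takes a new value at `a`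
    have key : ∀ {γ : Type} [DecidableEq γ] (k : ℝ → γ),
        (∀ x ∈ insert a s, ∀ y ∈ insert a s, ∀ z ∈ insert a s, x < y → y < z → k x = k z →
          k y = k z) → k m ≠ k a → k a ∉ s.image k := by
      intro γ _ k hk hka h
      obtain ⟨x, hx, hxa⟩ := Finset.mem_image.1 h
      have hxm : x ≤ m := s.le_max' x hx
      rcases hxm.lt_or_eq with hlt | heq
      · exact hka (hk x (Finset.mem_insert_of_mem hx) m (Finset.mem_insert_of_mem hms) a
          (Finset.mem_insert_self _ _) hlt hma hxa)
      · rw [heq] at hxa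
        exact hka hxa
    have hf1 : (s.image f).card ≤ (insert (f a) (s.image f)).card :=
      Finset.card_le_card (Finset.subset_insert _ _)
    have hg1 : (s.image g).card ≤ (insert (g a) (s.image g)).card :=
      Finset.card_le_card (Finset.subset_insert _ _)
    by_cases hfa : f m = f a
    · have hga : g m ≠ g a := fun h => hne (Prod.ext hfa h)
      rw [Finset.card_insert_of_notMem (key g hg hga)]
      omega
    · rw [Finset.card_insert_of_notMem (key f hf hfa)]
      omega

/-! ## Exposed points: uniqueness, convexity in the slope, decomposition over a Minkowski sum -/

/-- The strict maximiser of `ℓ_t = t·x + σ·y` over `S` is unique. [folklore] -/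
theorem exposed_unique {S : Set (Fin 2 → ℝ)} {σ t : ℝ} {p p' : Fin 2 → ℝ}
    (hp : p ∈ S) (hp' : p' ∈ S)
    (h : ∀ q ∈ S, q ≠ p → t * q 0 + σ * q 1 < t * p 0 + σ * p 1)
    (h' : ∀ q ∈ S, q ≠ p' → t * q 0 + σ * q 1 < t * p' 0 + σ * p' 1) : p = p' := by
  by_contra hne
  have h1 := h p' hp' (Ne.symm hne)
  have h2 := h' p hp hne
  linarith

/-- The set of slopes `t` at which a fixed point `p` is the strict maximiser of `ℓ_t` over `S` is
order-convex (`ℓ_t p - ℓ_t q` is affine in `t`). [folklore] -/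
theorem exposed_between {S : Set (Fin 2 → ℝ)} {σ t₁ t₂ t₃ : ℝ} {p : Fin 2 → ℝ}
    (h₁ : ∀ q ∈ S, q ≠ p → t₁ * q 0 + σ * q 1 < t₁ * p 0 + σ * p 1)
    (h₃ : ∀ q ∈ S, q ≠ p → t₃ * q 0 + σ * q 1 < t₃ * p 0 + σ * p 1)
    (h12 : t₁ ≤ t₂) (h23 : t₂ ≤ t₃) :
    ∀ q ∈ S, q ≠ p → t₂ * q 0 + σ * q 1 < t₂ * p 0 + σ * p 1 := by
  intro q hq hqp
  have a := h₁ q hq hqp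
  have b := h₃ q hq hqp
  rcases le_total (q 0) (p 0) with h | h
  · have := mul_le_mul_of_nonneg_right h12 (sub_nonneg.2 h)
    nlinarith
  · have := mul_le_mul_of_nonpos_right h23 (sub_nonpos.2 h)
    nlinarith

/-- Over a Minkowski sum `S + T`, the strict maximiser of `ℓ_t` is the sum of the strict
maximisers over `S` and over `T`. [folklore] -/
theorem exposed_add_decomp {S T : Set (Fin 2 → ℝ)} {σ t : ℝ} {p : Fin 2 → ℝ} (hp : p ∈ S + T)
    (h : ∀ q ∈ S + T, q ≠ p → t * q 0 + σ * q 1 < t * p 0 + σ * p 1) :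
    ∃ s ∈ S, ∃ u ∈ T, p = s + u ∧
      (∀ q ∈ S, q ≠ s → t * q 0 + σ * q 1 < t * s 0 + σ * s 1) ∧
      (∀ q ∈ T, q ≠ u → t * q 0 + σ * q 1 < t * u 0 + σ * u 1) := by
  obtain ⟨s, hs, u, hu, rfl⟩ := Set.mem_add.1 hp
  refine ⟨s, hs, u, hu, rfl, fun q hq hqs => ?_, fun q hq hqu => ?_⟩
  · have hmem : q + u ∈ S + T := Set.add_mem_add hq hu
    have hne : q + u ≠ s + u := fun e => hqs (add_right_cancel e)
    have := h _ hmem hne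
    simp only [Pi.add_apply] at this
    linarith
  · have hmem : s + q ∈ S + T := Set.add_mem_add hs hq
    have hne : s + q ≠ s + u := fun e => hqu (add_left_cancel e)
    have := h _ hmem hne
    simp only [Pi.add_apply] at this
    linarith

/-- A *maximiser function*: some `F : ℝ → ℝ²` returns, at every slope `t` admitting one, the
strict maximiser of `ℓ_t` over `S`. [folklore] -/
theorem exists_maximiser_fn (S : Set (Fin 2 → ℝ)) (σ : ℝ) : ∃ F : ℝ → (Fin 2 → ℝ), ∀ t s, s ∈ S →
    (∀ q ∈ S, q ≠ s → t * q 0 + σ * q 1 < t * s 0 + σ * s 1) → F t = s := by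
  classical
  refine ⟨fun t => if h : ∃ s ∈ S, ∀ q ∈ S, q ≠ s → t * q 0 + σ * q 1 < t * s 0 + σ * s 1
    then h.choose else 0, fun t s hs hEs => ?_⟩
  have h : ∃ s ∈ S, ∀ q ∈ S, q ≠ s → t * q 0 + σ * q 1 < t * s 0 + σ * s 1 := ⟨s, hs, hEs⟩
  dsimp only
  rw [dif_pos h]
  exact exposed_unique h.choose_spec.1 hs h.choose_spec.2 hEs

/-- Along a set of slopes at each of which a maximiser function hits a strict maximiser, its
fibres are intervals (`exposed_between`). [folklore] -/
theorem maximiser_fn_interval {S : Set (Fin 2 → ℝ)} {σ : ℝ} {Q : Finset ℝ} {F : ℝ → (Fin 2 → ℝ)}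
    (hF : ∀ t s, s ∈ S → (∀ q ∈ S, q ≠ s → t * q 0 + σ * q 1 < t * s 0 + σ * s 1) → F t = s)
    (hFQ : ∀ a ∈ Q, F a ∈ S ∧ ∀ q ∈ S, q ≠ F a → a * q 0 + σ * q 1 < a * (F a) 0 + σ * (F a) 1) :
    ∀ a ∈ Q, ∀ b ∈ Q, ∀ c ∈ Q, a < b → b < c → F a = F c → F b = F c := by
  intro a ha b _ c hc hab hbc hac
  have hEa := (hFQ a ha).2
  rw [hac] at hEa
  exact hF _ _ (hFQ c hc).1 (exposed_between hEa (hFQ c hc).2 hab.le hbc.le)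

/-! ## Subadditivity of exposed points under union and Minkowski sum -/

/-- A strict maximiser over `S ∪ T` is a strict maximiser over whichever of `S`, `T` contains it;
hence `σ`-exposed points are subadditive under union. [folklore] -/
theorem ncard_exposed_union_le (S T : Set (Fin 2 → ℝ)) (hS : S.Finite) (hT : T.Finite) (σ : ℝ) :
    {p | p ∈ S ∪ T ∧ ∃ t : ℝ, ∀ q ∈ S ∪ T, q ≠ p → t * q 0 + σ * q 1 < t * p 0 + σ * p 1}.ncard ≤
      {p | p ∈ S ∧ ∃ t : ℝ, ∀ q ∈ S, q ≠ p → t * q 0 + σ * q 1 < t * p 0 + σ * p 1}.ncard +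
      {p | p ∈ T ∧ ∃ t : ℝ, ∀ q ∈ T, q ≠ p → t * q 0 + σ * q 1 < t * p 0 + σ * p 1}.ncard := by
  refine le_trans (Set.ncard_le_ncard ?_ ?_) (Set.ncard_union_le _ _)
  · rintro p ⟨hp, t, ht⟩
    rcases hp with hp | hp
    · exact Or.inl ⟨hp, t, fun q hq hqp => ht q (Or.inl hq) hqp⟩
    · exact Or.inr ⟨hp, t, fun q hq hqp => ht q (Or.inr hq) hqp⟩
  · exact (hS.subset (fun p hp => hp.1)).union (hT.subset (fun p hp => hp.1))

/-- **Exposed points are subadditive under Minkowski sum (plane).** The strict maximiser of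
`ℓ_t` over `S + T` is `F t + G t` with `F t`, `G t` the strict maximisers over `S`, `T`; along
increasing `t` the fibres of `F`, `G` are intervals (`exposed_between`), so by the sweep lemma the
number of distinct pairs is at most `#exposed(S) + #exposed(T) - 1`. [folklore] -/
theorem ncard_exposed_add_le (S T : Set (Fin 2 → ℝ)) (hS : S.Finite) (hT : T.Finite) (σ : ℝ) :
    {p | p ∈ S + T ∧ ∃ t : ℝ, ∀ q ∈ S + T, q ≠ p → t * q 0 + σ * q 1 < t * p 0 + σ * p 1}.ncard ≤
      {p | p ∈ S ∧ ∃ t : ℝ, ∀ q ∈ S, q ≠ p → t * q 0 + σ * q 1 < t * p 0 + σ * p 1}.ncard +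
      {p | p ∈ T ∧ ∃ t : ℝ, ∀ q ∈ T, q ≠ p → t * q 0 + σ * q 1 < t * p 0 + σ * p 1}.ncard := by
  classical
  -- the three exposed sets and their finiteness
  set US := {p | p ∈ S ∧ ∃ t : ℝ, ∀ q ∈ S, q ≠ p → t * q 0 + σ * q 1 < t * p 0 + σ * p 1} with hUS
  set UT := {p | p ∈ T ∧ ∃ t : ℝ, ∀ q ∈ T, q ≠ p → t * q 0 + σ * q 1 < t * p 0 + σ * p 1} with hUT
  set P := {p | p ∈ S + T ∧ ∃ t : ℝ, ∀ q ∈ S + T, q ≠ p → t * q 0 + σ * q 1 < t * p 0 + σ * p 1}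
    with hPdef
  have hUSfin : US.Finite := hS.subset (fun p hp => hp.1)
  have hUTfin : UT.Finite := hT.subset (fun p hp => hp.1)
  have hPfin : P.Finite := (hS.add hT).subset (fun p hp => hp.1)
  rcases P.eq_empty_or_nonempty with h0 | hPne
  · rw [h0, Set.ncard_empty]; exact Nat.zero_le _
  -- a witness slope for every exposed point of `S + T`
  have hτ : ∃ τ : (Fin 2 → ℝ) → ℝ, ∀ p ∈ P,
      ∀ q ∈ S + T, q ≠ p → τ p * q 0 + σ * q 1 < τ p * p 0 + σ * p 1 := by
    refine ⟨fun p => if h : p ∈ P then h.2.choose else 0, fun p hp => ?_⟩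
    dsimp only
    rw [dif_pos hp]
    exact hp.2.choose_spec
  obtain ⟨τ, hτ⟩ := hτ
  -- the maximiser functions over `S` and over `T`
  obtain ⟨F, hF⟩ := exists_maximiser_fn S σ
  obtain ⟨G, hG⟩ := exists_maximiser_fn T σ
  -- at a witness slope, `F` and `G` recover the decomposition of the exposed point
  have hdec : ∀ p ∈ P, F (τ p) ∈ US ∧ G (τ p) ∈ UT ∧ F (τ p) + G (τ p) = p ∧
      (∀ q ∈ S, q ≠ F (τ p) → τ p * q 0 + σ * q 1 < τ p * (F (τ p)) 0 + σ * (F (τ p)) 1) ∧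
      (∀ q ∈ T, q ≠ G (τ p) → τ p * q 0 + σ * q 1 < τ p * (G (τ p)) 0 + σ * (G (τ p)) 1) := by
    intro p hp
    obtain ⟨s, hs, u, hu, hpsu, hEs, hEu⟩ := exposed_add_decomp hp.1 (hτ p hp)
    have hFs : F (τ p) = s := hF _ s hs hEs
    have hGu : G (τ p) = u := hG _ u hu hEu
    rw [hFs, hGu]
    exact ⟨⟨hs, _, hEs⟩, ⟨hu, _, hEu⟩, hpsu.symm, hEs, hEu⟩
  -- the finite set of witness slopes
  set Q : Finset ℝ := hPfin.toFinset.image τ with hQ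
  have hτinj : Set.InjOn τ P := by
    intro p hp p' hp' hpp
    have h1 := hτ p hp
    have h2 := hτ p' hp'
    rw [hpp] at h1
    exact exposed_unique hp.1 hp'.1 h1 h2
  have hQcard : Q.card = P.ncard := by
    rw [hQ, Finset.card_image_of_injOn (by simpa using hτinj), Set.ncard_eq_toFinset_card P hPfin]
  have hQmem : ∀ t ∈ Q, ∃ p ∈ P, τ p = t := fun t ht => by
    simpa [hQ] using ht
  have hQne : Q.Nonempty := by
    obtain ⟨p, hp⟩ := hPne
    exact ⟨τ p, Finset.mem_image_of_mem τ (hPfin.mem_toFinset.2 hp)⟩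
  -- interval fibres of `F` and `G` along `Q`
  have hFconv := maximiser_fn_interval (Q := Q) hF fun a ha => by
    obtain ⟨pa, hpa, rfl⟩ := hQmem a ha
    exact ⟨(hdec pa hpa).1.1, (hdec pa hpa).2.2.2.1⟩
  have hGconv := maximiser_fn_interval (Q := Q) hG fun a ha => by
    obtain ⟨pa, hpa, rfl⟩ := hQmem a ha
    exact ⟨(hdec pa hpa).2.1.1, (hdec pa hpa).2.2.2.2⟩
  -- joint injectivity of `(F, G)` on `Q`
  have hFGinj : Set.InjOn (fun t => (F t, G t)) Q := by
    intro a ha b hb hab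
    obtain ⟨pa, hpa, rfl⟩ := hQmem a (Finset.mem_coe.1 ha)
    obtain ⟨pb, hpb, rfl⟩ := hQmem b (Finset.mem_coe.1 hb)
    simp only [Prod.mk.injEq] at hab
    have : pa = pb := by
      rw [← (hdec pa hpa).2.2.1, ← (hdec pb hpb).2.2.1, hab.1, hab.2]
    rw [this]
  -- the images of `Q` under `F`, `G` lie in the exposed sets of `S`, `T`
  have him : ∀ (K : ℝ → (Fin 2 → ℝ)) (U : Set (Fin 2 → ℝ)), U.Finite → (∀ p ∈ P, K (τ p) ∈ U) →
      (Q.image K).card ≤ U.ncard := fun K U hU hK => by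
    rw [← Set.ncard_coe_finset]
    refine Set.ncard_le_ncard (fun s hs => ?_) hU
    obtain ⟨t, ht, rfl⟩ := Finset.mem_image.1 (Finset.mem_coe.1 hs)
    obtain ⟨p, hp, rfl⟩ := hQmem t ht
    exact hK p hp
  have hFim := him F US hUSfin fun p hp => (hdec p hp).1
  have hGim := him G UT hUTfin fun p hp => (hdec p hp).2.1
  have hsweep := card_succ_le_card_image_add Q F G hFconv hGconv hFGinj hQne
  omega

/-! ## Vertices of the hull are exposed in an upper or a lower direction -/

/-- A vertex of the convex hull of `S` does not lie in the hull of the other points. [folklore] -/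
theorem not_mem_convexHull_diff_of_mem_extremePoints {E : Type*} [AddCommGroup E] [Module ℝ E]
    {S : Set E} {p : E} (hp : p ∈ (convexHull ℝ S).extremePoints ℝ) :
    p ∉ convexHull ℝ (S \ {p}) := by
  intro hmem
  have hsub : convexHull ℝ S ⊆ convexHull ℝ (S \ {p}) := by
    refine convexHull_min (fun q hq => ?_) (convex_convexHull ℝ _)
    by_cases hqp : q = p
    · rw [hqp]; exact hmem
    · exact subset_convexHull ℝ _ ⟨hq, hqp⟩
  have heq : convexHull ℝ (S \ {p}) = convexHull ℝ S :=
    Set.Subset.antisymm (convexHull_mono (fun x hx => hx.1)) hsub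
  have hp' : p ∈ (convexHull ℝ (S \ {p})).extremePoints ℝ := by rw [heq]; exact hp
  exact (extremePoints_convexHull_subset hp').2 rfl

/-- A vertex of the convex hull of a finite set is strictly separated from the other points by a
continuous linear functional (geometric Hahn–Banach). [folklore] -/
theorem exists_strict_functional_of_mem_extremePoints {S : Set (Fin 2 → ℝ)} (hS : S.Finite)
    {p : Fin 2 → ℝ} (hp : p ∈ (convexHull ℝ S).extremePoints ℝ) :
    p ∈ S ∧ ∃ a b : ℝ, ∀ q ∈ S, q ≠ p → a * q 0 + b * q 1 < a * p 0 + b * p 1 := by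
  refine ⟨extremePoints_convexHull_subset hp, ?_⟩
  have hnot := not_mem_convexHull_diff_of_mem_extremePoints hp
  have hclosed : IsClosed (convexHull ℝ (S \ {p})) :=
    (hS.subset (fun x hx => hx.1)).isClosed_convexHull ℝ
  obtain ⟨f, u, hfu, hup⟩ :=
    geometric_hahn_banach_closed_point (convex_convexHull ℝ (S \ {p})) hclosed hnot
  have hlin : ∀ q : Fin 2 → ℝ, f q = f (Pi.single 0 1) * q 0 + f (Pi.single 1 1) * q 1 := by
    intro q
    have hq : q = q 0 • (Pi.single 0 1 : Fin 2 → ℝ) + q 1 • (Pi.single 1 1 : Fin 2 → ℝ) := by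
      funext i
      fin_cases i <;> simp
    conv_lhs => rw [hq]
    rw [f.map_add, f.map_smul, f.map_smul, smul_eq_mul, smul_eq_mul]
    ring
  refine ⟨f (Pi.single 0 1), f (Pi.single 1 1), fun q hq hqp => ?_⟩
  rw [← hlin q, ← hlin p]
  exact (hfu q (subset_convexHull ℝ _ ⟨hq, hqp⟩)).trans hup

/-- A strict linear separation `a·x + b·y` of `p` from the finite set `S ∖ {p}` can be turned into
an upper (`σ = 1`) or lower (`σ = -1`) exposing direction `t·x + σ·y`: rescale if `b ≠ 0`, and
tilt the vertical direction slightly if `b = 0`. [folklore] -/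
theorem exposed_of_strict_functional {S : Set (Fin 2 → ℝ)} (hS : S.Finite) {p : Fin 2 → ℝ}
    {a b : ℝ} (h : ∀ q ∈ S, q ≠ p → a * q 0 + b * q 1 < a * p 0 + b * p 1) :
    (∃ t : ℝ, ∀ q ∈ S, q ≠ p → t * q 0 + 1 * q 1 < t * p 0 + 1 * p 1) ∨
      (∃ t : ℝ, ∀ q ∈ S, q ≠ p → t * q 0 + (-1) * q 1 < t * p 0 + (-1) * p 1) := by
  rcases lt_trichotomy b 0 with hb | hb | hb
  · -- `b < 0`: divide by `-b`
    refine Or.inr ⟨a / (-b), fun q hq hqp => ?_⟩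
    have h1 := h q hq hqp
    have hnb : 0 < -b := neg_pos.2 hb
    have hb0 : b ≠ 0 := hb.ne
    have e1 : a / (-b) * q 0 + (-1) * q 1 = (a * q 0 + b * q 1) / (-b) := by
      field_simp
      ring
    have e2 : a / (-b) * p 0 + (-1) * p 1 = (a * p 0 + b * p 1) / (-b) := by
      field_simp
      ring
    rw [e1, e2]
    exact (div_lt_div_iff_of_pos_right hnb).2 h1
  · -- `b = 0`: the direction is `± x` (`0 < a (p 0 - q 0)` for `q ≠ p`); tilt it slightly
    subst hb
    left
    obtain ⟨q₀, hq₀⟩ :=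
      Set.exists_upper_bound_image S (fun q => (q 1 - p 1) / (a * (p 0 - q 0))) hS
    refine ⟨a * ((q₀ 1 - p 1) / (a * (p 0 - q₀ 0)) + 1), fun q hq hqp => ?_⟩
    have hd : 0 < a * (p 0 - q 0) := by have := h q hq hqp; linarith
    have hlt : (q 1 - p 1) / (a * (p 0 - q 0)) < (q₀ 1 - p 1) / (a * (p 0 - q₀ 0)) + 1 := by
      linarith [hq₀ q hq]
    rw [div_lt_iff₀ hd] at hlt
    nlinarith
  · -- `b > 0`: divide by `b`
    refine Or.inl ⟨a / b, fun q hq hqp => ?_⟩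
    have h1 := h q hq hqp
    have e1 : a / b * q 0 + 1 * q 1 = (a * q 0 + b * q 1) / b := by
      field_simp
    have e2 : a / b * p 0 + 1 * p 1 = (a * p 0 + b * p 1) / b := by
      field_simp
    rw [e1, e2]
    exact (div_lt_div_iff_of_pos_right hb).2 h1

/-- **Vertices are upper- or lower-exposed.** For finite `S ⊆ ℝ²`, the number of vertices of
`conv S` is at most the number of `1`-exposed plus the number of `(-1)`-exposed points of `S`.
[folklore] -/
theorem ncard_extremePoints_convexHull_le (S : Set (Fin 2 → ℝ)) (hS : S.Finite) :
    ((convexHull ℝ S).extremePoints ℝ).ncard ≤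
      {p | p ∈ S ∧ ∃ t : ℝ, ∀ q ∈ S, q ≠ p → t * q 0 + 1 * q 1 < t * p 0 + 1 * p 1}.ncard +
      {p | p ∈ S ∧
        ∃ t : ℝ, ∀ q ∈ S, q ≠ p → t * q 0 + (-1) * q 1 < t * p 0 + (-1) * p 1}.ncard := by
  refine le_trans (Set.ncard_le_ncard ?_ ?_) (Set.ncard_union_le _ _)
  · intro p hp
    obtain ⟨hpS, a, b, hab⟩ := exists_strict_functional_of_mem_extremePoints hS hp
    rcases exposed_of_strict_functional hS hab with h | h
    · exact Or.inl ⟨hpS, h⟩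
    · exact Or.inr ⟨hpS, h⟩
  · exact (hS.subset (fun p hp => hp.1)).union (hS.subset (fun p hp => hp.1))

/-! ## The registered helper statement -/

/-- **Planar exposed-point geometry (registered helper stub for `stub_tropicalWordBound`).** The
three facts above bundled into one statement: `σ`-exposed points of finite planar sets are
subadditive under union and under Minkowski sum (`Set.image2 (+)`), and the vertices of the convex
hull of a finite planar set are `1`-exposed or `(-1)`-exposed. [folklore] -/
theorem stub_exposedPlanarGeometry :
    (∀ (S T : Set (Fin 2 → ℝ)), S.Finite → T.Finite → ∀ σ : ℝ,
      Set.ncard {p : Fin 2 → ℝ | p ∈ S ∪ T ∧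
        ∃ t : ℝ, ∀ q ∈ S ∪ T, q ≠ p → t * q 0 + σ * q 1 < t * p 0 + σ * p 1} ≤
      Set.ncard {p : Fin 2 → ℝ | p ∈ S ∧
        ∃ t : ℝ, ∀ q ∈ S, q ≠ p → t * q 0 + σ * q 1 < t * p 0 + σ * p 1} +
      Set.ncard {p : Fin 2 → ℝ | p ∈ T ∧
        ∃ t : ℝ, ∀ q ∈ T, q ≠ p → t * q 0 + σ * q 1 < t * p 0 + σ * p 1}) ∧
    (∀ (S T : Set (Fin 2 → ℝ)), S.Finite → T.Finite → ∀ σ : ℝ,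
      Set.ncard {p : Fin 2 → ℝ | p ∈ Set.image2 (fun x y : Fin 2 → ℝ => x + y) S T ∧
        ∃ t : ℝ, ∀ q ∈ Set.image2 (fun x y : Fin 2 → ℝ => x + y) S T, q ≠ p →
          t * q 0 + σ * q 1 < t * p 0 + σ * p 1} ≤
      Set.ncard {p : Fin 2 → ℝ | p ∈ S ∧
        ∃ t : ℝ, ∀ q ∈ S, q ≠ p → t * q 0 + σ * q 1 < t * p 0 + σ * p 1} +
      Set.ncard {p : Fin 2 → ℝ | p ∈ T ∧
        ∃ t : ℝ, ∀ q ∈ T, q ≠ p → t * q 0 + σ * q 1 < t * p 0 + σ * p 1}) ∧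
    (∀ S : Set (Fin 2 → ℝ), S.Finite →
      Set.ncard (Set.extremePoints ℝ (convexHull ℝ S)) ≤
      Set.ncard {p : Fin 2 → ℝ | p ∈ S ∧
        ∃ t : ℝ, ∀ q ∈ S, q ≠ p → t * q 0 + 1 * q 1 < t * p 0 + 1 * p 1} +
      Set.ncard {p : Fin 2 → ℝ | p ∈ S ∧
        ∃ t : ℝ, ∀ q ∈ S, q ≠ p → t * q 0 + (-1) * q 1 < t * p 0 + (-1) * p 1}) := by
  refine ⟨fun S T hS hT σ => ncard_exposed_union_le S T hS hT σ, fun S T hS hT σ => ?_,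
    fun S hS => ncard_extremePoints_convexHull_le S hS⟩
  rw [Set.image2_add]
  exact ncard_exposed_add_le S T hS hT σ

end Summit.ValiantsHypothesis.ValiantsHypothesis.Theorems.ElementaryWordLengthWordPerSuperPoly
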